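import Summits.QuantumFields.YangMills.Theorems.BalabanUVNodesK0S5NearCentredAnyLevel
import Summits.QuantumFields.YangMills.Theorems.BalabanUVNodesN07Letters10OfWeightedRowsNearTop
import HarnessLib

/-!
# N07 [B11] (= [15] = [Balaban1985Variational]) Sect. F, road of record R0′, S6 HEAD — **THE OUTWARD MEET EDITION, FILE A: THE S5 → S6 DOORS ON A WINDOW OF NEAR-TOP CELLS**
# ([15] p. 301 (147)–(150): at a cube `□` meeting `Ω_k` but not `Ω_{k+1}` the per-cube family is print's `Ω′_j = □_j (j < k)`, `Ω′_k = □″_k = □_k ∩ Ω_k` — the levelwise MEET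
# of the cube tower with the record (dag-n07-e `OUTWARD-MEET-EDITION-SPEC.md`) — and the window `□` then carries cells of the meet at BOTH levels `k` («□″_k^{(k)}») and `k − 1`
# («□′_k^{(k−1)}»): every S5 → S6 door of the tree (`…_nearClassW`, the uniform-datum door, the shear-datum door) asks the window over the TOP domain `Ω_k` of the family;
# this file re-derives them for a window over `Ω_{k−1} ⊇ Ω_k` of the family — the `ℓ = 1` NEAR-TOP EDITIONS — with IDENTICAL binder blocks and thresholds (the factor `L⁴` of the
# near-top junction p615261 and the factor `2` of one more (2.60) layer in the tilt are absorbed into the doors' existential constant `C`)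

Cell `pub-ymgap`, width seat `pub-ymgap-dag-n07-w4` g5 (sub-target S6 = the HEAD; MODULE 57 default pen, n07-e OUTWARD-MEET-EDITION-SPEC (E1)∕(E3)∕(E4)), CLAIM-1 ∕ INTENT-1 (cell bus).
`--kind proof --supports stmt-QuantumFields-27364 --as helper` (K1⁹ per dag-lead KEY MAP v2); count-neutral; def-free.
[15] = [Balaban1985Variational]; [4] = [Balaban1984PropagatorsII]; [6] = [Balaban1985RegularSpaces].

THE POINT.  k0-s1-w3's S5 socket `K0S5NearClassSocket.hbRows164_core_of_adm22_T4_nearClassW` (the (164) rows of the canonical flat `H` of an admissible family, near class a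
predicate) asks the observation bond's base point in the TOP domain, `D.InOm (K − n) b₋`, and every door built on it (`K0S5FarCollarLetters.letters10On_HB_of_core_adm22_T4_nearClassW`,
`K0S5NearCentredAnyLevel.letters10On_HB_boxWindow_of_centred_nearClassW`, `K0S5UniformDatumDoor.letters10On_H_uniform_of_core_adm22_T4`,
`N07PureGaugeShiftLetters.letters10On_extension_of_uniformDatum_adm22_T4`) asks the window over `Ω_{K−n}` of the family.  The top membership is read at ONE place only: the exported
(2.60) layer separation `(R·L·M_h − 1)·(i − j(c) − 1) ≤ dBI b c` (`b₋ ∈ Ω_i`, `j(c) < i`, k0-s1-w3 P11 `hRowsSep_of_adm22_T4`) is taken at `i = K − n`, i.e. with `gap = 1` in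
`K0S5FarSlotWeighted.rows164_quarter_levelRadii_farW`; at a base point of level `K − n − 1` the same separation holds with `gap = 2` (one (163′)-factor `2` more), and the S5 weights
`w_m(b) = (L^{j(b₋)}·L^{−(K−n)})^m ≥ L^{−m}` there cost `L⁴` in the plain rows (n07-w4 p615261 `letters10On_of_weightedRowsNearTop`, `ℓ = 1`).  Both factors are constants of `F`,
so they ride in the existential `C` and every near-top door below has its top-window parent's binder block VERBATIM except `D.InOm (K − n − 1)` in place of `D.InOm (K − n)`.

WHAT IS PROVED (sorry-free; no definition; axioms standard).
§1 `levelSep_gap_two` (bookkeeping); ★★ `hbRows164_core_of_adm22_T4_nearClassW_nearTop (F)` — the S5 socket at a base point of level `≥ K − n − 1` (`gap = 2`; constant `2C`).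
§2 ★ `letters10On_extension_of_weightedRowsNearTop` — p601315's extension junction on a window of cells of level `≥ k − ℓ` (p615261 ∘ p601315 §1).
§3 ★★★ `letters10On_HB_of_core_adm22_T4_nearClassW_nearTop (F N)` — the `HB` door, near class a predicate, window over `Ω_{K−n−1}` of the family (constant `2L⁴C`).
§4 ★★★ `letters10On_HB_boxWindow_of_centred_nearClassW_nearTop (F N)` — k0-s1-w3's boundary-datum door (centred near data at every level, far data uniform `β₂(ρ + M)`), window box
   over `Ω_{K−n−1}`.
§5 ★★ `letters10On_H_uniform_of_core_adm22_T4_nearTop (F N)` — the uniform-datum door (`A₃ = H_V 𝔇(A′)`), window over `Ω_{K−n−1}`.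
§6 ★★ `letters10On_extension_of_uniformDatum_adm22_T4_nearTop (F N)` — the shear-datum door `‖X c‖ ≤ ς·L^{K−n−j(c)}` (road R0′ row (r2)'s root), window over `Ω_{K−n−1}`.
HONEST SCOPE.  Count-neutral re-derivations BY NAME of landed S5∕S6 doors with one hypothesis weakened; nothing of [15]∕[4]∕[6] ANALYSIS asserted beyond citing the landed kernel rows
(P11) and the (161) ⇒ (164) chain (k0-s1-w3) by name; the family, its admissibility, the window, the data, the kernel formula are HYPOTHESES; `stub_prop8StepCoPG13` ∕ K0⁷ ∕ K1⁹ NOT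
closed; N07 NOT discharged; counts unmoved (typed 28∕28 · discharged 5∕27); one finite 𝕋⁴ programme at fixed ε — the route closes the conditional finite-𝕋⁴ rung `BalabanLadder.UV`
ONLY; the YM mass gap (Clay) is NOT proved by any of this; nothing continuum ∕ ℝ⁴ ∕ OS.  No `sorry`, no `def`, no `instance`, no `notation`.

RELATED, NOT DUPLICATED: the top-window parents named above (proofs re-run with the weaker hypothesis), P11 `hRowsSep_of_adm22_T4`, k0-s1-w3 `rows164_quarter_levelRadii_farW`.
References: [15] (144) p. 300, (147)–(150) p. 301, (155) p. 302, (160)–(165) pp. 303–304; [4] (2.1)–(2.4) p. 224, (2.19) p. 226, (2.60) p. 234, Cor. 2.8 p. 249; [6] (1.140) p. 100.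
-/

set_option autoImplicit false

noncomputable section

open scoped BigOperators Matrix.Norms.L2Operator

namespace Summit.QuantumFields.YangMills.BalabanUVNodes.N07Letters10NearTopDoors

open Literature.MathematicalPhysics.QuantumFieldTheory.Balaban1983to89
open Literature.MathematicalPhysics.QuantumFieldTheory.Balaban1983to89.Node00
open B15Eq112TorusCover (cover)
open B14DomainGeom (Pt)
open B8Eq131Cubes (box)
open B6SectADomainsV1 (Domains)
open B6SectAOperatorsV1 (BondIdx dcE dcsE)
open B11Eq161HBChainLevelRadii (le_two_pow_mul_of_comparable)
open T4Continuum (T4Family)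
open B5Eq117TorusCarriers (Mk)
open B5Eq118OneStroke (iterBlockOf)
open B5Prop12FieldsLattice (distSite)
open Summit.QuantumFields.YangMills.Theorems.FlatCubeOpsText (Adm22 distBI)
open Summit.QuantumFields.YangMills.Theorems.K0FlatCubeOpsTextP (IsLevWeight flatH levWeight_nonneg)
open Summit.QuantumFields.YangMills.Theorems.K0FlatHBBound164P (bondIdx_level_le)
open Summit.QuantumFields.YangMills.Theorems.K0FlatPortKernelRowsSepP (hRowsSep_of_adm22_T4)
open Summit.QuantumFields.YangMills.Theorems.K0S5HBRows164CoreCubeSeq (two_le_exp_quarter)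
open Summit.QuantumFields.YangMills.Theorems.HalvingQuarterCubeSeq (distBI_nonneg)
open Summit.QuantumFields.YangMills.Theorems.K0S5FarSlotWeighted (rows164_quarter_levelRadii_farW coef_nonneg_of_abs_le_mul)
open Summit.QuantumFields.YangMills.Theorems.K0S5NearCentredAnyLevel (near_of_centred_box_anyLevel)
open Summit.QuantumFields.YangMills.BalabanUVNodes.N07HalvingStepTopOfLocalLetters (Letters10On)
open Summit.QuantumFields.YangMills.BalabanUVNodes.N07Letters10OfExtension (reFunctional_extension_apply reFunctional_extension)
open Summit.QuantumFields.YangMills.BalabanUVNodes.N07Letters10OfWeightedRowsNearTop (letters10On_of_weightedRowsNearTop)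

/-! ## §1  The S5 socket at a base point of level `≥ K − n − 1` (one more (2.60) layer in the tilt: `gap = 2`) -/

/-- `G ≥ 0`, `d ≥ 0`, `1 ≤ k`, and either `j < k − 1` with the layer separation `G·((k − 1) − j − 1) ≤ d` (base point at level `k − 1`, P11's export), or `j ≥ k − 1`: in all cases
`G·(k − j − 2) ≤ d`. [cite: Balaban1984PropagatorsII, (2.60) p.234, bookkeeping] -/
theorem levelSep_gap_two {G d : ℝ} {k j : ℕ} (hG : 0 ≤ G) (hd : 0 ≤ d) (hk1 : 1 ≤ k)
    (hsep : j < k - 1 → G * ((((k - 1 : ℕ) : ℕ) : ℝ) - (j : ℕ) - (1 : ℕ)) ≤ d) : G * ((k : ℝ) - (j : ℕ) - (2 : ℕ)) ≤ d := by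
  by_cases hlt : j < k - 1
  · have h := hsep hlt
    have hcast : (((k - 1 : ℕ) : ℕ) : ℝ) = (k : ℝ) - 1 := by rw [Nat.cast_sub hk1]; simp
    rw [hcast] at h
    have e : G * ((k : ℝ) - 1 - (j : ℕ) - (1 : ℕ)) = G * ((k : ℝ) - (j : ℕ) - (2 : ℕ)) := by push_cast; ring
    rwa [e] at h
  · have hkj : k ≤ j + 1 := by omega
    have hkj' : (k : ℝ) ≤ (j : ℕ) + 1 := by exact_mod_cast hkj
    have hneg : (k : ℝ) - (j : ℕ) - (2 : ℕ) ≤ 0 := by push_cast; linarith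
    nlinarith [mul_nonneg hG (neg_nonneg.mpr hneg)]

/-- ★★ **THE S5 SOCKET AT A BASE POINT OF LEVEL `≥ K − n − 1`** — k0-s1-w3's `K0S5NearClassSocket.hbRows164_core_of_adm22_T4_nearClassW` with the observation bond's base point only in
`Ω_{K−n−1} ⊇ Ω_{K−n}` of the family (`D.InOm (K − n − 1) b₋`; the outward part `□′_k^{(k−1)}` of print's window at a boundary datum), every other binder VERBATIM: the (2.60) layer term
is P11's exported separation at `i = K − n − 1`, i.e. `(R·L·M_h − 1)·(K − n − j(c) − 2) ≤ dBI b c` for `j(c) < K − n − 1` and `≤ 0 ≤ dBI` otherwise — `gap = 2` in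
`rows164_quarter_levelRadii_farW`, whose extra (163′)-factor `2` is absorbed into the exported constant (`2C`).  Conclusion: the four left-weighted rows of `flatH` at `b` are
`≤ ¼M_Δ·max{4C_dCB₃ε₁, θ·ε(K − n)}`. [cite: Balaban1985Variational, (144) p.300, (147)–(150) p.301, (155) p.302, (160)–(164) pp.303–304; Balaban1984PropagatorsII, (2.1)–(2.2) p.224, (2.60) p.234, Cor. 2.8 p.249; Balaban1987RG1, (0.1) p.251] -/
theorem hbRows164_core_of_adm22_T4_nearClassW_nearTop (F : T4Family) :
    ∃ (Mh₀ R₀ : ℕ) (C δ₀ δ₁ B₃ : ℝ), 0 ≤ C ∧ 0 < δ₀ ∧ 0 < δ₁ ∧ 0 < B₃ ∧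
    ∀ (n K : ℕ) (_ : 1 ≤ K - n) (_ : K - n + 1 ≤ F.m + K) {Mh R a' : ℕ} (_ : Mh = F.L ^ a') (_ : Mh₀ ≤ Mh) (_ : R₀ ≤ R) (_ : a' + 3 ≤ F.m + n)
      (D : Domains (F.P K)) (_ : D.k = K - n) (_ : Adm22 D R (F.L * Mh))
      (w : ℕ → PBond (F.P K) 0 → ℝ) (_ : IsLevWeight (F.P K) (K - n) D w)
      {Cd MΔ ε₁ θ R' : ℝ} {ε : ℕ → ℝ}
      (_ : 0 ≤ Cd) (_ : 0 ≤ MΔ) (_ : 0 ≤ ε₁) (_ : 0 ≤ ε (K - n)) (_ : ∀ j, j < K - n → ε j ≤ 2 * ε (j + 1))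
      (_ : 8 * Cd * C * B₃ * Real.exp (-(δ₁ * R')) ≤ θ)
      (near : BondIdx D → Prop) {X : BondIdx D → ℝ} {b : PBond (F.P K) 0}
      (_ : D.InOm (K - n - 1) b.src) (_ : ∀ c : BondIdx D, ¬ near c → R' ≤ distBI D b c)
      (_ : ∀ c, near c → |X c| ≤ Cd * MΔ * ε₁ * ((F.P K).L : ℝ) ^ ((K - n) - (c.1.1 : ℕ)) * (distBI D b c + 1))
      (_ : ∀ c, ¬ near c → |X c| ≤ Cd * MΔ * ε (c.1.1 : ℕ) * ((F.P K).L : ℝ) ^ ((K - n) - (c.1.1 : ℕ)) * (distBI D b c + 1)),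
      w 1 b * (w 1 b * |flatH (F.P K) (K - n) D X b|) ≤
        1 / 4 * MΔ * max (4 * Cd * C * B₃ * ε₁) (θ * ε (K - n)) ∧
      (∀ ν : Fin (F.P K).d, w 1 b * (w 2 b * ((F.P K).L : ℝ) ^ (K - n) *
          |flatH (F.P K) (K - n) D X ⟨b.src.shift ν, b.dir⟩ -
            flatH (F.P K) (K - n) D X b|) ≤
        1 / 4 * MΔ * max (4 * Cd * C * B₃ * ε₁) (θ * ε (K - n))) ∧
      w 1 b * (w 3 b * |(dcsE (((F.P K).L : ℝ) ^ (K - n)) (dcE (((F.P K).L : ℝ) ^ (K - n))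
          (WithLp.toLp 2 (flatH (F.P K) (K - n) D X)))) b|) ≤
        1 / 4 * MΔ * max (4 * Cd * C * B₃ * ε₁) (θ * ε (K - n)) ∧
      w 1 b * (w 3 b * (((F.P K).L : ℝ) ^ (K - n)) ^ 2 *
          |∑ ν : Fin (F.P K).d, ((flatH (F.P K) (K - n) D X b -
              flatH (F.P K) (K - n) D X ⟨b.src.shift ν, b.dir⟩) +
            (flatH (F.P K) (K - n) D X b -
              flatH (F.P K) (K - n) D X ⟨b.src.unshift ν, b.dir⟩))|) ≤
        1 / 4 * MΔ * max (4 * Cd * C * B₃ * ε₁) (θ * ε (K - n)) := by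
  obtain ⟨Mh₀, R₀, C, δ₀, B₃, hC, hδ₀, hB₃, hmain⟩ := hRowsSep_of_adm22_T4 F
  refine ⟨Mh₀, max R₀ (⌈4 * Real.log 2 / δ₀⌉₊ + 2), 2 * C, δ₀, δ₀ / 4, B₃, by positivity, hδ₀, div_pos hδ₀ four_pos, hB₃, ?_⟩
  intro n K hk1 hk' Mh R a' hMha hMh hR hsize D hDk hAdm w hw Cd MΔ ε₁ θ R' ε hCd hMΔ hε₁ hεk hcomp h163 near X b hbΩ hcollar hnear hfar
  have hR₀ : R₀ ≤ R := le_trans (le_max_left _ _) hR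
  obtain ⟨-, -, dBI, hcompD, hsep, hrow, hdec⟩ := hmain n K hk1 hk' hMha hMh hR₀ hsize D hDk hAdm w hw
  -- `1 ≤ L·M_h`
  have hM : 1 ≤ F.L * Mh := by
    rw [hMha]
    exact Nat.one_le_iff_ne_zero.mpr (Nat.mul_ne_zero (by have := F.hL11; omega) (pow_ne_zero _ (by have := F.hL11; omega)))
  -- the per-layer gap `G₀ = R·L·M_h − 1 ≥ 0` and the tilt `τ = ¼δ₀`
  set G₀ : ℝ := ((R * (F.L * Mh) - 1 : ℕ) : ℝ) with hG₀def
  have hG₀0 : 0 ≤ G₀ := by rw [hG₀def]; exact Nat.cast_nonneg _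
  have hRq : ⌈4 * Real.log 2 / δ₀⌉₊ + 2 ≤ R := le_trans (le_max_right _ _) hR
  have hRM : R ≤ R * (F.L * Mh) := Nat.le_mul_of_pos_right R hM
  have hnat : ⌈4 * Real.log 2 / δ₀⌉₊ + 1 ≤ R * (F.L * Mh) - 1 := by omega
  have hG₀ : 4 * Real.log 2 / δ₀ ≤ G₀ := by
    have h1 : (4 * Real.log 2 / δ₀ : ℝ) ≤ ⌈4 * Real.log 2 / δ₀⌉₊ := Nat.le_ceil _
    have h2 : ((⌈4 * Real.log 2 / δ₀⌉₊ + 1 : ℕ) : ℝ) ≤ G₀ := by rw [hG₀def]; exact_mod_cast hnat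
    push_cast at h2
    linarith
  have h2 : 2 ≤ Real.exp (δ₀ / 4 * G₀) := two_le_exp_quarter hδ₀ hG₀
  have hτ : (0 : ℝ) ≤ δ₀ / 4 := by positivity
  have hτδ : δ₀ / 4 ≤ δ₀ / 2 := by linarith
  -- (163′) at `gap = 2`: `4C_dCB₃·(e^{−¼δ₀R′}·2²) = 8C_d(2C)B₃e^{−¼δ₀R′} ≤ θ`
  have h163' : 4 * Cd * C * B₃ * (Real.exp (-((δ₀ / 2 - δ₀ / 4) * R')) * (2 : ℝ) ^ (2 : ℕ)) ≤ θ := by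
    have e : δ₀ / 2 - δ₀ / 4 = δ₀ / 4 := by ring
    rw [e]
    calc 4 * Cd * C * B₃ * (Real.exp (-(δ₀ / 4 * R')) * (2 : ℝ) ^ (2 : ℕ)) = 8 * Cd * (2 * C) * B₃ * Real.exp (-(δ₀ / 4 * R')) := by ring
      _ ≤ θ := h163
  have hd0 : ∀ c, 0 ≤ dBI b c := fun c => (distBI_nonneg _ b c).trans (hcompD b c)
  -- NEAR cells: (160) with its level weight, transported along `distBI ≤ dBI`
  have hnear' : ∀ c, near c → |X c| ≤ Cd * MΔ * ε₁ * ((dBI b c + 1) * ((F.P K).L : ℝ) ^ ((K - n) - (c.1.1 : ℕ))) := by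
    intro c hc
    have h := hnear c hc
    have hcoef : 0 ≤ Cd * MΔ * ε₁ * ((F.P K).L : ℝ) ^ ((K - n) - (c.1.1 : ℕ)) := coef_nonneg_of_abs_le_mul (distBI_nonneg D b c) h
    calc |X c| ≤ Cd * MΔ * ε₁ * ((F.P K).L : ℝ) ^ ((K - n) - (c.1.1 : ℕ)) * (dBI b c + 1) :=
          h.trans (mul_le_mul_of_nonneg_left (by linarith [hcompD b c]) hcoef)
      _ = Cd * MΔ * ε₁ * ((dBI b c + 1) * ((F.P K).L : ℝ) ^ ((K - n) - (c.1.1 : ℕ))) := by ring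
  -- FAR cells: the weighted (155), the consumer's collar, and the (2.60) layer term at `gap = 2` from the base point's level `K − n − 1`
  have hfar' : ∀ c, ¬ near c →
      |X c| ≤ Cd * MΔ * ε (c.1.1 : ℕ) * ((F.P K).L : ℝ) ^ ((K - n) - (c.1.1 : ℕ)) * (dBI b c + 1) ∧ R' ≤ dBI b c ∧
        G₀ * (((K - n : ℕ) : ℝ) - (c.1.1 : ℕ) - (2 : ℕ)) ≤ dBI b c := by
    intro c hc
    have h := hfar c hc
    have hcoef : 0 ≤ Cd * MΔ * ε (c.1.1 : ℕ) * ((F.P K).L : ℝ) ^ ((K - n) - (c.1.1 : ℕ)) :=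
      coef_nonneg_of_abs_le_mul (distBI_nonneg D b c) h
    refine ⟨h.trans (mul_le_mul_of_nonneg_left (by linarith [hcompD b c]) hcoef), (hcollar c hc).trans (hcompD b c), ?_⟩
    refine levelSep_gap_two hG₀0 (hd0 c) hk1 fun hlt => ?_
    have hs := hsep (K - n - 1) b c (Nat.sub_le _ _) hbΩ hlt
    simpa [hG₀def] using hs
  have hrows := rows164_quarter_levelRadii_farW (gap := 2) hdec hrow hC hCd hMΔ hε₁ hεk (fun _ hj => le_two_pow_mul_of_comparable hcomp hj) hτ hτδ h2 h163'
    near (levWeight_nonneg hw 1 b) hd0 (bondIdx_level_le hDk) hnear' hfar'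
  -- the bound is monotone in the constant: `C ≤ 2C`
  have hmono : 1 / 4 * MΔ * max (4 * Cd * C * B₃ * ε₁) (θ * ε (K - n)) ≤ 1 / 4 * MΔ * max (4 * Cd * (2 * C) * B₃ * ε₁) (θ * ε (K - n)) := by
    refine mul_le_mul_of_nonneg_left (max_le_max ?_ le_rfl) (by positivity)
    have : 0 ≤ Cd * C * B₃ * ε₁ := by positivity
    nlinarith
  exact ⟨hrows.1.trans hmono, fun ν => (hrows.2.1 ν).trans hmono, hrows.2.2.1.trans hmono, hrows.2.2.2.trans hmono⟩

/-! ## §2  The extension junction on a window of near-top cells -/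

variable {P : Params} {N : ℕ}

/-- ★ **PRINT's THREE LETTERS OF `G_V B` ON A WINDOW OF CELLS OF LEVEL `≥ k − ℓ` FROM THE WEIGHTED REAL ROWS OF `g`** — p601315's `letters10On_extension_of_weightedRowsTop` with
`Y ⊆ {x | D.InOm (k − ℓ) x}` (`ℓ ≤ k`) and the threshold `L^{4ℓ}·q < t` (p615261's near-top junction behind the kernel identity `φ ∘ G_V = g(φ ∘ ·)`).
[cite: Balaban1985Variational, (161) p.303, (164)–(165) p.304, (150) p.301, p.286; Balaban1984PropagatorsII, (2.3)–(2.4) p.224, (2.19) p.226] -/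
theorem letters10On_extension_of_weightedRowsNearTop [NeZero N] {ι : Type*} [Fintype ι] [DecidableEq ι]
    {k : ℕ} {D : Domains P} (hDk : D.k = k) {w : ℕ → PBond P 0 → ℝ} (hw : IsLevWeight P k D w) {ℓ : ℕ} (hℓ : ℓ ≤ k)
    {Y : Set (Site P 0)} (hY : ∀ x ∈ Y, D.InOm (k - ℓ) x) {q t : ℝ} (hq : 0 ≤ q) (hqt : (P.L : ℝ) ^ (4 * ℓ) * q < t)
    (g : (ι → ℝ) →ₗ[ℝ] (PBond P 0 → ℝ)) {Gv : (ι → MatA N) →ₗ[ℂ] (PBond P 0 → MatA N)}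
    (hGv : ∀ (A : ι → MatA N) (b : PBond P 0), Gv A b = ∑ i, ((g (Pi.single i 1) b : ℝ) : ℂ) • A i) {B : ι → MatA N}
    (hrows : ∀ X : ι → ℝ, (∀ i, |X i| ≤ ‖B i‖) → ∀ b : PBond P 0, b.src ∈ Y →
      w 1 b * (w 1 b * |g X b|) ≤ q ∧
      (∀ ν : Fin P.d, w 1 b * (w 2 b * (P.L : ℝ) ^ k * |g X ⟨b.src.shift ν, b.dir⟩ - g X b|) ≤ q) ∧
      w 1 b * (w 3 b * |(dcsE ((P.L : ℝ) ^ k) (dcE ((P.L : ℝ) ^ k) (WithLp.toLp 2 (g X)))) b|) ≤ q) :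
    Letters10On Y (P.eta k) t (Gv B) := by
  have _ := hDk
  refine letters10On_of_weightedRowsNearTop hw hℓ hY hq hqt fun f u r hf b hb => ?_
  have hX : ∀ i, |r * (u * f (B i)).re| ≤ ‖B i‖ := fun i => hf (B i)
  obtain ⟨h1, h2, h3⟩ := hrows (fun i => r * (u * f (B i)).re) hX b hb
  refine ⟨?_, fun ν => ?_, ?_⟩
  · rw [reFunctional_extension_apply g hGv]; exact h1
  · rw [reFunctional_extension_apply g hGv, reFunctional_extension_apply g hGv]; exact h2 ν
  · rw [reFunctional_extension g hGv]; exact h3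

/-! ## §3  The `HB` door, near class a predicate, on a window over `Ω_{K−n−1}` of the family -/

open scoped Classical in
/-- ★★★ **[15] (164) ⇒ THE THREE (165)-LETTERS OF `HB = H_V B`, NEAR CLASS A PREDICATE, WINDOW OF NEAR-TOP CELLS** — k0-s1-w3's `letters10On_HB_of_core_adm22_T4_nearClassW` with the window
only over `Ω_{K−n−1} ⊇ Ω_{K−n}` of the family (`∀ x ∈ Y, D.InOm (K − n − 1) x`), every other binder and the threshold `t > ¼M_Δ·max{4C_dCB₃ε₁, θ·ε(K − n)}` VERBATIM (§1 ∘ §2 at `ℓ = 1`;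
the junction's `L⁴` and §1's `2` ride in the constant: `C := 2L⁴·C_{P11}`, the far coefficient is read internally at `θ∕L⁴`).
[cite: Balaban1985Variational, (147)–(150) p.301, (155) p.302, (160)–(161) p.303, (163)–(165) p.304; Balaban1985RegularSpaces, (1.140) p.100; Balaban1984PropagatorsII, (2.3)–(2.4) p.224] -/
theorem letters10On_HB_of_core_adm22_T4_nearClassW_nearTop (F : T4Family) (N : ℕ) [NeZero N] :
    ∃ (Mh₀ R₀ : ℕ) (C δ₀ δ₁ B₃ : ℝ), 0 ≤ C ∧ 0 < δ₀ ∧ 0 < δ₁ ∧ 0 < B₃ ∧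
    ∀ (n K : ℕ) (_ : 1 ≤ K - n) (_ : K - n + 1 ≤ F.m + K) {Mh R a' : ℕ} (_ : Mh = F.L ^ a') (_ : Mh₀ ≤ Mh) (_ : R₀ ≤ R) (_ : a' + 3 ≤ F.m + n)
      (D : Domains (F.P K)) (_ : D.k = K - n) (_ : Adm22 D R (F.L * Mh))
      (w : ℕ → PBond (F.P K) 0 → ℝ) (_ : IsLevWeight (F.P K) (K - n) D w)
      {Cd MΔ ε₁ θ R' : ℝ} {ε : ℕ → ℝ}
      (_ : 0 ≤ Cd) (_ : 0 ≤ MΔ) (_ : 0 ≤ ε₁) (_ : 0 ≤ ε (K - n)) (_ : ∀ j, j < K - n → ε j ≤ 2 * ε (j + 1))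
      (_ : 8 * Cd * C * B₃ * Real.exp (-(δ₁ * R')) ≤ θ)
      (near : BondIdx D → Prop) {Y : Set (Site (F.P K) 0)} (_ : ∀ x ∈ Y, D.InOm (K - n - 1) x)
      (_ : ∀ b : PBond (F.P K) 0, b.src ∈ Y → ∀ c : BondIdx D, ¬ near c → R' ≤ distBI D b c)
      {HV : (BondIdx D → MatA N) →ₗ[ℂ] (PBond (F.P K) 0 → MatA N)}
      (_ : ∀ (A : BondIdx D → MatA N) (b : PBond (F.P K) 0), HV A b = ∑ c, ((flatH (F.P K) (K - n) D (Pi.single c 1) b : ℝ) : ℂ) • A c)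
      {B : BondIdx D → MatA N}
      (_ : ∀ b : PBond (F.P K) 0, b.src ∈ Y → ∀ c : BondIdx D, near c →
        ‖B c‖ ≤ Cd * MΔ * ε₁ * ((F.P K).L : ℝ) ^ ((K - n) - (c.1.1 : ℕ)) * (distBI D b c + 1))
      (_ : ∀ b : PBond (F.P K) 0, b.src ∈ Y → ∀ c : BondIdx D, ¬ near c →
        ‖B c‖ ≤ Cd * MΔ * ε (c.1.1 : ℕ) * ((F.P K).L : ℝ) ^ ((K - n) - (c.1.1 : ℕ)) * (distBI D b c + 1))
      {t : ℝ} (_ : 1 / 4 * MΔ * max (4 * Cd * C * B₃ * ε₁) (θ * ε (K - n)) < t),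
      Letters10On Y ((F.P K).eta (K - n)) t (HV B) := by
  obtain ⟨Mh₀, R₀, C, δ₀, δ₁, B₃, hC, hδ₀, hδ₁, hB₃, hmain⟩ := hbRows164_core_of_adm22_T4_nearClassW_nearTop F
  refine ⟨Mh₀, R₀, (F.L : ℝ) ^ 4 * C, δ₀, δ₁, B₃, by positivity, hδ₀, hδ₁, hB₃, ?_⟩
  intro n K hk1 hk' Mh R a' hMha hMh hR hsize D hDk hAdm w hw Cd MΔ ε₁ θ R' ε hCd hMΔ hε₁ hεk hcomp h163 near Y hY hcollar HV hHv B hBnear hBfar t ht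
  have hL4 : (0 : ℝ) < (F.L : ℝ) ^ 4 := by have := F.hL11; positivity
  have hL4' : ((F.P K).L : ℝ) ^ (4 * 1) = (F.L : ℝ) ^ 4 := by rw [mul_one]; rfl
  -- the far coefficient read at `θ∕L⁴`
  have h163' : 8 * Cd * C * B₃ * Real.exp (-(δ₁ * R')) ≤ θ / (F.L : ℝ) ^ 4 := by
    rw [le_div_iff₀ hL4]
    calc 8 * Cd * C * B₃ * Real.exp (-(δ₁ * R')) * (F.L : ℝ) ^ 4 = 8 * Cd * ((F.L : ℝ) ^ 4 * C) * B₃ * Real.exp (-(δ₁ * R')) := by ring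
      _ ≤ θ := h163
  have hq : 0 ≤ 1 / 4 * MΔ * max (4 * Cd * C * B₃ * ε₁) (θ / (F.L : ℝ) ^ 4 * ε (K - n)) :=
    mul_nonneg (mul_nonneg (by norm_num) hMΔ) (le_max_of_le_left (by positivity))
  have hqt : ((F.P K).L : ℝ) ^ (4 * 1) * (1 / 4 * MΔ * max (4 * Cd * C * B₃ * ε₁) (θ / (F.L : ℝ) ^ 4 * ε (K - n))) < t := by
    rw [hL4']
    have hL0 : (F.L : ℝ) ^ 4 ≠ 0 := hL4.ne'
    have e1 : (F.L : ℝ) ^ 4 * (4 * Cd * C * B₃ * ε₁) = 4 * Cd * ((F.L : ℝ) ^ 4 * C) * B₃ * ε₁ := by ring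
    have e2 : (F.L : ℝ) ^ 4 * (θ / (F.L : ℝ) ^ 4 * ε (K - n)) = θ * ε (K - n) := by
      rw [← mul_assoc, mul_div_cancel₀ θ hL0]
    have e : (F.L : ℝ) ^ 4 * (1 / 4 * MΔ * max (4 * Cd * C * B₃ * ε₁) (θ / (F.L : ℝ) ^ 4 * ε (K - n))) =
        1 / 4 * MΔ * max (4 * Cd * ((F.L : ℝ) ^ 4 * C) * B₃ * ε₁) (θ * ε (K - n)) := by
      rw [show (F.L : ℝ) ^ 4 * (1 / 4 * MΔ * max (4 * Cd * C * B₃ * ε₁) (θ / (F.L : ℝ) ^ 4 * ε (K - n))) =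
          1 / 4 * MΔ * ((F.L : ℝ) ^ 4 * max (4 * Cd * C * B₃ * ε₁) (θ / (F.L : ℝ) ^ 4 * ε (K - n))) by ring, mul_max_of_nonneg _ _ hL4.le, e1, e2]
    rw [e]; exact ht
  refine letters10On_extension_of_weightedRowsNearTop hDk hw (ℓ := 1) hk1 hY hq hqt (flatH (F.P K) (K - n) D) hHv fun X hX b hb => ?_
  have hrows := hmain n K hk1 hk' hMha hMh hR hsize D hDk hAdm w hw hCd hMΔ hε₁ hεk hcomp h163' near (X := X) (b := b) (hY b.src hb)
    (hcollar b hb) (fun c hc => (hX c).trans (hBnear b hb c hc)) (fun c hc => (hX c).trans (hBfar b hb c hc))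
  exact ⟨hrows.1, hrows.2.1, hrows.2.2.1⟩

/-! ## §4  The `HB` door on a window BOX over `Ω_{K−n−1}`: centred near data at every level, far data uniform -/

open scoped Classical in
/-- ★★★ **THE `HB`-LETTERS ON A WINDOW BOX OVER `Ω_{K−n−1}` OF THE FAMILY, NEAR CLASS FREE, DATA IN PRINT's SHAPES** — k0-s1-w3's `letters10On_HB_boxWindow_of_centred_nearClassW` with the
window box only over `Ω_{K−n−1}` of the family (the boundary datum's print box at print's (150) family: cells of `□″_k^{(k)}` AND `□′_k^{(k−1)}`), every other binder and the threshold
`t > ¼·M·max{4CB₃β₁, θ·β₂}` VERBATIM (§3 ∘ `near_of_centred_box_anyLevel`). [cite: Balaban1985Variational, (144) p.300, (147)–(150) p.301, (155) p.302, (160)–(161) p.303, (163)–(165) p.304] -/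
theorem letters10On_HB_boxWindow_of_centred_nearClassW_nearTop (F : T4Family) (N : ℕ) [NeZero N] :
    ∃ (Mh₀ R₀ : ℕ) (C δ₀ δ₁ B₃ : ℝ), 0 ≤ C ∧ 0 < δ₀ ∧ 0 < δ₁ ∧ 0 < B₃ ∧
    ∀ (n K : ℕ) (_ : 1 ≤ K - n) (_ : K - n + 1 ≤ F.m + K) {Mh R a' : ℕ} (_ : Mh = F.L ^ a') (_ : Mh₀ ≤ Mh) (_ : R₀ ≤ R) (_ : a' + 3 ≤ F.m + n)
      (D : Domains (F.P K)) (hDk : D.k = K - n) (_ : Adm22 D R (F.L * Mh))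
      (w : ℕ → PBond (F.P K) 0 → ℝ) (_ : IsLevWeight (F.P K) (K - n) D w)
      {a : Pt (F.P K).d} {M ρ : ℕ} (_ : 1 ≤ M)
      (_ : ∀ x ∈ cover (F.P K) '' box (F.P K).L a M (K - n), D.InOm (K - n - 1) x)
      {xc : Pt (F.P K).d} (_ : xc ∈ box (F.P K).L a M (K - n))
      (near : BondIdx D → Prop)
      (_ : ∀ b : PBond (F.P K) 0, b.src ∈ cover (F.P K) '' box (F.P K).L a M (K - n) → ∀ c : BondIdx D, ¬ near c → (ρ : ℝ) ≤ distBI D b c)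
      {β₁ β₂ θ : ℝ} (_ : 0 ≤ β₁) (_ : 0 ≤ β₂) (_ : 8 * C * B₃ * Real.exp (-(δ₁ * (ρ : ℝ))) ≤ θ)
      {HV : (BondIdx D → MatA N) →ₗ[ℂ] (PBond (F.P K) 0 → MatA N)}
      (_ : ∀ (A : BondIdx D → MatA N) (b : PBond (F.P K) 0), HV A b = ∑ c, ((flatH (F.P K) (K - n) D (Pi.single c 1) b : ℝ) : ℂ) • A c)
      {B : BondIdx D → MatA N}
      (_ : ∀ c : BondIdx D, near c → ‖B c‖ ≤ β₁ * (distSite (Mk (F.P K) (c.1.1 : ℕ)) c.1.2.src (iterBlockOf (c.1.1 : ℕ) (cover (F.P K) xc)) + 1))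
      (_ : ∀ c : BondIdx D, ¬ near c → ‖B c‖ ≤ β₂ * ((ρ : ℝ) + M))
      {t : ℝ} (_ : 1 / 4 * (M : ℝ) * max (4 * C * B₃ * β₁) (θ * β₂) < t),
      Letters10On (cover (F.P K) '' box (F.P K).L a M (K - n)) ((F.P K).eta (K - n)) t (HV B) := by
  obtain ⟨Mh₀, R₀, C, δ₀, δ₁, B₃, hC, hδ₀, hδ₁, hB₃, hmain⟩ := letters10On_HB_of_core_adm22_T4_nearClassW_nearTop F N
  refine ⟨Mh₀, R₀, C, δ₀, δ₁, B₃, hC, hδ₀, hδ₁, hB₃, ?_⟩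
  intro n K hk1 hk' Mh R a' hMha hMh hR hsize D hDk hAdm w hw a M ρ hM hY xc hxc near hcollar β₁ β₂ θ hβ₁ hβ₂ h163 HV hHv B hX₁ hX₂ t ht
  have hMr : (1 : ℝ) ≤ M := by exact_mod_cast hM
  have hM0 : (0 : ℝ) ≤ M := by linarith
  have hL1 : (1 : ℝ) ≤ ((F.P K).L : ℝ) := by exact_mod_cast (F.P K).L_pos
  have hkK : D.k ≤ (F.P K).m + (F.P K).K := D.hk
  -- the near hypothesis from the centred bound at every level (`C_d·M_Δ·ε₁ := β₁·M`), the far one from the collar and `L^{k−j} ≥ 1`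
  have hxc' : xc ∈ box (F.P K).L a M D.k := by rw [hDk]; exact hxc
  have hnear := near_of_centred_box_anyLevel D (a := a) (M := M) hkK hM hxc' near hβ₁ hX₁
  refine hmain n K hk1 hk' hMha hMh hR hsize D hDk hAdm w hw (Cd := 1) (MΔ := (M : ℝ)) (ε₁ := β₁) (θ := θ) (R' := (ρ : ℝ))
    (ε := fun _ => β₂) zero_le_one hM0 hβ₁ hβ₂ (fun _ _ => by linarith) (by simpa using h163) near hY hcollar hHv
    (fun b hb c hc => ?_) (fun b hb c hc => ?_) (by simpa using ht)
  · have hb' : b.src ∈ cover (F.P K) '' box (F.P K).L a M D.k := by rw [hDk]; exact hb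
    have h := hnear b hb' c hc
    have hKk : D.k - (c.1.1 : ℕ) = (K - n) - (c.1.1 : ℕ) := by omega
    rw [hKk] at h
    calc ‖B c‖ ≤ β₁ * M * ((F.P K).L : ℝ) ^ ((K - n) - (c.1.1 : ℕ)) * (distBI D b c + 1) := h
      _ = 1 * (M : ℝ) * β₁ * ((F.P K).L : ℝ) ^ ((K - n) - (c.1.1 : ℕ)) * (distBI D b c + 1) := by ring
  · have hpow : (1 : ℝ) ≤ ((F.P K).L : ℝ) ^ ((K - n) - (c.1.1 : ℕ)) := one_le_pow₀ hL1
    have hρd : (ρ : ℝ) ≤ distBI D b c := hcollar b hb c hc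
    have hd0 : (0 : ℝ) ≤ distBI D b c := (Nat.cast_nonneg ρ).trans hρd
    calc ‖B c‖ ≤ β₂ * ((ρ : ℝ) + M) := hX₂ c hc
      _ ≤ β₂ * (M * (distBI D b c + 1)) := mul_le_mul_of_nonneg_left (by nlinarith) hβ₂
      _ = β₂ * M * 1 * (distBI D b c + 1) := by ring
      _ ≤ β₂ * M * ((F.P K).L : ℝ) ^ ((K - n) - (c.1.1 : ℕ)) * (distBI D b c + 1) :=
          mul_le_mul_of_nonneg_right (mul_le_mul_of_nonneg_left hpow (by positivity)) (by linarith)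
      _ = 1 * (M : ℝ) * β₂ * ((F.P K).L : ℝ) ^ ((K - n) - (c.1.1 : ℕ)) * (distBI D b c + 1) := by ring

/-! ## §5  The uniform-datum door on a window over `Ω_{K−n−1}` -/

open scoped Classical in
/-- ★★ **THE `H`-LETTERS FOR A DATUM OF UNIFORM SIZE, ANY ADMISSIBLE FAMILY, WINDOW OVER `Ω_{K−n−1}`** (the door for `A₃ = H_V 𝔇(A′)` at a boundary datum) — k0-s1-w3's
`letters10On_H_uniform_of_core_adm22_T4` with `∀ x ∈ Y, D.InOm (K − n − 1) x`, every other binder and the threshold `t > 2·C·B₃·s` VERBATIM (§3 with the near class everything, `R′ = 0`,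
`θ := 8CB₃`). [cite: Balaban1985Variational, (157) p.302, (159) p.303, (164)–(165) p.304; Balaban1984PropagatorsII, Cor. 2.8 (2.150)–(2.151) p.249] -/
theorem letters10On_H_uniform_of_core_adm22_T4_nearTop (F : T4Family) (N : ℕ) [NeZero N] :
    ∃ (Mh₀ R₀ : ℕ) (C δ₀ δ₁ B₃ : ℝ), 0 ≤ C ∧ 0 < δ₀ ∧ 0 < δ₁ ∧ 0 < B₃ ∧
    ∀ (n K : ℕ) (_ : 1 ≤ K - n) (_ : K - n + 1 ≤ F.m + K) {Mh R a' : ℕ} (_ : Mh = F.L ^ a') (_ : Mh₀ ≤ Mh) (_ : R₀ ≤ R) (_ : a' + 3 ≤ F.m + n)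
      (D : Domains (F.P K)) (_ : D.k = K - n) (_ : Adm22 D R (F.L * Mh))
      (w : ℕ → PBond (F.P K) 0 → ℝ) (_ : IsLevWeight (F.P K) (K - n) D w)
      {Y : Set (Site (F.P K) 0)} (_ : ∀ x ∈ Y, D.InOm (K - n - 1) x)
      {HV : (BondIdx D → MatA N) →ₗ[ℂ] (PBond (F.P K) 0 → MatA N)}
      (_ : ∀ (A : BondIdx D → MatA N) (b : PBond (F.P K) 0), HV A b = ∑ c, ((flatH (F.P K) (K - n) D (Pi.single c 1) b : ℝ) : ℂ) • A c)
      {B : BondIdx D → MatA N} {s : ℝ} (_ : 0 ≤ s) (_ : ∀ c, ‖B c‖ ≤ s)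
      {t : ℝ} (_ : 2 * C * B₃ * s < t),
      Letters10On Y ((F.P K).eta (K - n)) t (HV B) := by
  obtain ⟨Mh₀, R₀, C, δ₀, δ₁, B₃, hC, hδ₀, hδ₁, hB₃, hmain⟩ := letters10On_HB_of_core_adm22_T4_nearClassW_nearTop F N
  refine ⟨Mh₀, R₀, C, δ₀, δ₁, B₃, hC, hδ₀, hδ₁, hB₃, ?_⟩
  intro n K hk1 hk' Mh R a' hMha hMh hR hsize D hDk hAdm w hw Y hY HV hHv B s hs hB t ht
  have hL1 : (1 : ℝ) ≤ ((F.P K).L : ℝ) := by exact_mod_cast (F.P K).L_pos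
  -- the (163)-row at `R′ := 0` with `θ := 8CB₃`; the threshold `¼·max{4CB₃s, 8CB₃s} = 2CB₃s`
  have h163 : 8 * (1 : ℝ) * C * B₃ * Real.exp (-(δ₁ * 0)) ≤ 8 * C * B₃ := by simp
  have hmax : 1 / 4 * (1 : ℝ) * max (4 * 1 * C * B₃ * s) (8 * C * B₃ * s) < t := by
    have hCB : 0 ≤ C * B₃ * s := by positivity
    rw [max_eq_right (by nlinarith)]
    linarith
  refine hmain n K hk1 hk' hMha hMh hR hsize D hDk hAdm w hw (Cd := 1) (MΔ := 1) (ε₁ := s) (θ := 8 * C * B₃) (R' := 0) (ε := fun _ => s)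
    zero_le_one zero_le_one hs hs (fun _ _ => by linarith) h163 (fun _ => True) hY (fun b _ c hc => absurd trivial hc) hHv
    (fun b _ c _ => ?_) (fun b _ c hc => absurd trivial hc) hmax
  -- the near shape: `s ≤ s·L^{k−j}·(distBI + 1)`
  have hd := distBI_nonneg D b c
  have hpow : (1 : ℝ) ≤ ((F.P K).L : ℝ) ^ ((K - n) - (c.1.1 : ℕ)) := one_le_pow₀ hL1
  calc ‖B c‖ ≤ s := hB c
    _ = s * 1 * 1 := by ring
    _ ≤ s * ((F.P K).L : ℝ) ^ ((K - n) - (c.1.1 : ℕ)) * (distBI D b c + 1) :=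
        mul_le_mul (mul_le_mul_of_nonneg_left hpow hs) (by linarith) zero_le_one (by positivity)
    _ = 1 * 1 * s * ((F.P K).L : ℝ) ^ ((K - n) - (c.1.1 : ℕ)) * (distBI D b c + 1) := by ring

/-! ## §6  The shear-datum door (road R0′, row (r2)'s root) on a window over `Ω_{K−n−1}` -/

open scoped Classical in
/-- ★★ **PRINT's THREE LETTERS OF `G := H_V X` FOR A DATUM `‖X(c)‖ ≤ ς·L^{(K−n)−j(c)}`, WINDOW OVER `Ω_{K−n−1}`** — `N07PureGaugeShiftLetters.letters10On_extension_of_uniformDatum_adm22_T4`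
with `∀ x ∈ Y, D.InOm (K − n − 1) x`, every other binder and the threshold `t > 2CB₃ς` VERBATIM (§3 with the near class everything: `ς·L^{k−j(c)} ≤ ς·L^{k−j(c)}·(distBI + 1)`, `R′ = 0`,
`θ := 8CB₃`). [cite: Balaban1985Variational, (161) p.303, (164)–(165) p.304, (168) p.304, p.288; Balaban1984PropagatorsII, (2.60) p.234, Cor. 2.8 (2.150)–(2.151) p.249] -/
theorem letters10On_extension_of_uniformDatum_adm22_T4_nearTop (F : T4Family) (N : ℕ) [NeZero N] :
    ∃ (Mh₀ R₀ : ℕ) (C δ₀ δ₁ B₃ : ℝ), 0 ≤ C ∧ 0 < δ₀ ∧ 0 < δ₁ ∧ 0 < B₃ ∧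
    ∀ (n K : ℕ) (_ : 1 ≤ K - n) (_ : K - n + 1 ≤ F.m + K) {Mh R a' : ℕ} (_ : Mh = F.L ^ a') (_ : Mh₀ ≤ Mh) (_ : R₀ ≤ R) (_ : a' + 3 ≤ F.m + n)
      (D : Domains (F.P K)) (_ : D.k = K - n) (_ : Adm22 D R (F.L * Mh))
      (w : ℕ → PBond (F.P K) 0 → ℝ) (_ : IsLevWeight (F.P K) (K - n) D w)
      {Y : Set (Site (F.P K) 0)} (_ : ∀ x ∈ Y, D.InOm (K - n - 1) x)
      {HV : (BondIdx D → MatA N) →ₗ[ℂ] (PBond (F.P K) 0 → MatA N)}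
      (_ : ∀ (A : BondIdx D → MatA N) (b : PBond (F.P K) 0), HV A b = ∑ c, ((flatH (F.P K) (K - n) D (Pi.single c 1) b : ℝ) : ℂ) • A c)
      {X : BondIdx D → MatA N} {ς : ℝ} (_ : 0 ≤ ς)
      (_ : ∀ c : BondIdx D, ‖X c‖ ≤ ς * ((F.P K).L : ℝ) ^ ((K - n) - (c.1.1 : ℕ)))
      {t : ℝ} (_ : 2 * C * B₃ * ς < t),
      Letters10On Y ((F.P K).eta (K - n)) t (HV X) := by
  obtain ⟨Mh₀, R₀, C, δ₀, δ₁, B₃, hC, hδ₀, hδ₁, hB₃, hmain⟩ := letters10On_HB_of_core_adm22_T4_nearClassW_nearTop F N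
  refine ⟨Mh₀, R₀, C, δ₀, δ₁, B₃, hC, hδ₀, hδ₁, hB₃, ?_⟩
  intro n K hk1 hk' Mh R a' hMha hMh hR hsize D hDk hAdm w hw Y hY HV hHV X ς hς hX t ht
  -- (163′) at `R′ = 0`, `θ := 8CB₃`, `C_d := 1`; the bound `¼·1·max{4·1·C·B₃·ς, 8CB₃·ς} = 2CB₃ς < t`
  have h163 : 8 * (1 : ℝ) * C * B₃ * Real.exp (-(δ₁ * 0)) ≤ 8 * C * B₃ := by
    rw [mul_zero, neg_zero, Real.exp_zero]; linarith
  have hCB : 0 ≤ C * B₃ * ς := mul_nonneg (mul_nonneg hC hB₃.le) hς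
  have hq : 1 / 4 * (1 : ℝ) * max (4 * 1 * C * B₃ * ς) (8 * C * B₃ * ς) < t := by
    rw [max_eq_right (by linarith)]; linarith
  refine hmain n K hk1 hk' hMha hMh hR hsize D hDk hAdm w hw (Cd := 1) (MΔ := 1) (ε₁ := ς) (θ := 8 * C * B₃) (R' := 0)
    (ε := fun _ => ς) zero_le_one zero_le_one hς hς (fun _ _ => by linarith) h163 (fun _ => True) hY (fun b _ c hc => absurd trivial hc) hHV
    (fun b _ c _ => ?_) (fun b _ c hc => absurd trivial hc) hq
  -- near (every cell): `‖X c‖ ≤ ς·L^{k−j} ≤ ς·L^{k−j}·(distBI + 1)`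
  have h := hX c
  have hd := distBI_nonneg D b c
  have hpow : (0 : ℝ) ≤ ((F.P K).L : ℝ) ^ ((K - n) - (c.1.1 : ℕ)) := by positivity
  calc ‖X c‖ ≤ ς * ((F.P K).L : ℝ) ^ ((K - n) - (c.1.1 : ℕ)) := h
    _ = ς * ((F.P K).L : ℝ) ^ ((K - n) - (c.1.1 : ℕ)) * 1 := by ring
    _ ≤ ς * ((F.P K).L : ℝ) ^ ((K - n) - (c.1.1 : ℕ)) * (distBI D b c + 1) :=
        mul_le_mul_of_nonneg_left (by linarith) (mul_nonneg hς hpow)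
    _ = 1 * 1 * ς * ((F.P K).L : ℝ) ^ ((K - n) - (c.1.1 : ℕ)) * (distBI D b c + 1) := by ring

end Summit.QuantumFields.YangMills.BalabanUVNodes.N07Letters10NearTopDoors

end
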